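import Summits.AtomisticToContinuum.HydrodynamicLimit.Theorems.OneFlightGossipEngineEnergyCurrentTailsLossIntensityFloor4MixingGlue
import HarnessLib

/-!
# QMF₄ ⟹ QMF₄ᴸ: the all-windows thermal mixing floor implies the lagged kinetic-window floor
# (stub `stub_quarticMixingFloor4L_of_mixingFloor4`, line `quartic-schur-ledger`, crux `EnergyCurrentTails`,
# stmt-AtomisticToContinuum-9235; seat c6 reshape A)

We prove that the all-windows thermal quartic mixing floor QMF₄ (seat c5's lower primitive: for every
time window `Set.Ioc s t ⊆ [0, T]` the thermal rate `c σ² (N+1)^{1/3}` times the time-integrated truncated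
quartic velocity moment under the local Gibbs law is dominated by the expected truncated quartic collision
flux collected over the same window) implies its lagged kinetic-window form QMF₄ᴸ, in which the window is
the single kinetic window `Set.Ioc s (s + h_N)`, `h_N = (N+1)^{-1/3}`, and the left time integral only runs
over the first half-window `Set.Ioc s (s + h_N / 2)`.  The proof is monotonicity of the set lintegral
(`Set.Ioc s (s + h_N / 2) ⊆ Set.Ioc s (s + h_N)`) applied to the QMF₄ instance `t = s + h_N`.

This certifies that the seat-c6 reshape A of the registered skeleton of the line `quartic-schur-ledger`
(replacing the open lower primitive QMF₄ by QMF₄ᴸ, which is all the absorbing recursion consumes) is a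
WEAKENING of the primitive, not a new assumption.
-/

noncomputable section

open MeasureTheory Set Filter
open scoped ENNReal InnerProductSpace

namespace Summit.AtomisticToContinuum.HydrodynamicLimit.Theorems.QuarticSchurLedger

open Literature.MathematicalPhysics.KineticTheory Literature.Analysis.FluidPDE

/-- **QMF₄ ⟹ QMF₄ᴸ** (registered sanity stub of the line `quartic-schur-ledger`, seat c6 reshape A):
the all-windows thermal quartic mixing floor implies the lagged kinetic-window floor with window
`h_N = (N+1)^{-1/3}` and left time integral over the first half-window; proof: instantiate the
all-windows floor at `t = s + h_N` and shrink the left time integral by `lintegral_mono_set`. -/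
theorem stub_quarticMixingFloor4L_of_mixingFloor4 :
    (∀ (a₀ θ₀ : T3 → ℝ) (u₀ : T3 → V3), Continuous a₀ → Continuous θ₀ → Continuous u₀ → (∀ x, 0 < a₀ x) → (∀
    x, 0 < θ₀ x) → ∃ σ₀ : ℝ, 0 < σ₀ ∧ ∀ σ : ℝ, 0 < σ → σ < σ₀ → ∀ T : ℝ, 0 < T → ∀ Φ : ((N : ℕ) →
    HardSphereFlow (Torus.geometry (Fin 3)) (hsDiameter σ N) (N + 1)), ∃ K₀ : ℝ, 0 ≤ K₀ ∧ ∃ c : ℝ, 0 < c ∧ ∃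
    N₀ : ℕ, ∀ N : ℕ, N₀ ≤ N → ∀ s t : ℝ, 0 ≤ s → s ≤ t → t ≤ T → ENNReal.ofReal (c * (σ ^ 2 * ((N + 1 : ℕ) :
    ℝ) ^ ((1 : ℝ) / 3))) * ∫⁻ τ in Set.Ioc s t, (∫⁻ z, ENNReal.ofReal (((N + 1 : ℕ) : ℝ)⁻¹ * ∑ i : Fin (N +
    1), if K₀ < ‖(((Φ N).flow τ z) i).2‖ then ‖(((Φ N).flow τ z) i).2‖ ^ 4 else 0) ∂(localGibbsLaw σ a₀ u₀
    θ₀ N (Φ N))) ≤ ∫⁻ z, (∑ᶠ τ ∈ collisionTimes (Torus.geometry (Fin 3)) (hsDiameter σ N) (fun r => (Φ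
    N).flow r z) ∩ Set.Ioc s t, ∑ i : Fin (N + 1), ∑ j : Fin (N + 1), if i = j then (0 : ℝ≥0∞) else
    (contactSet (Torus.geometry (Fin 3)) (N + 1) (hsDiameter σ N) i j).indicator (fun y => if K₀ <
    ‖((collidePair (Torus.geometry (Fin 3)) i j y) i).2‖ then ENNReal.ofReal (((N + 1 : ℕ) : ℝ)⁻¹ * (2 *
    (‖(y i).2‖ ^ 2 * ‖(y j).2‖ ^ 2))) else 0) ((Φ N).flow τ z)) ∂(localGibbsLaw σ a₀ u₀ θ₀ N (Φ N))) → ∀ (a₀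
    θ₀ : T3 → ℝ) (u₀ : T3 → V3), Continuous a₀ → Continuous θ₀ → Continuous u₀ → (∀ x, 0 < a₀ x) → (∀ x, 0 <
    θ₀ x) → ∃ σ₀ : ℝ, 0 < σ₀ ∧ ∀ σ : ℝ, 0 < σ → σ < σ₀ → ∀ T : ℝ, 0 < T → ∀ Φ : ((N : ℕ) → HardSphereFlow
    (Torus.geometry (Fin 3)) (hsDiameter σ N) (N + 1)), ∃ K₀ : ℝ, 0 ≤ K₀ ∧ ∃ c : ℝ, 0 < c ∧ ∃ N₀ : ℕ, ∀ N :
    ℕ, N₀ ≤ N → ∀ s : ℝ, 0 ≤ s → s + ((N : ℝ) + 1) ^ (-(1 / 3 : ℝ)) ≤ T → ENNReal.ofReal (c * (σ ^ 2 * ((N +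
    1 : ℕ) : ℝ) ^ ((1 : ℝ) / 3))) * ∫⁻ τ in Set.Ioc s (s + ((N : ℝ) + 1) ^ (-(1 / 3 : ℝ)) / 2), (∫⁻ z,
    ENNReal.ofReal (((N + 1 : ℕ) : ℝ)⁻¹ * ∑ i : Fin (N + 1), if K₀ < ‖(((Φ N).flow τ z) i).2‖ then ‖(((Φ
    N).flow τ z) i).2‖ ^ 4 else 0) ∂(localGibbsLaw σ a₀ u₀ θ₀ N (Φ N))) ≤ ∫⁻ z, (∑ᶠ τ ∈ collisionTimes
    (Torus.geometry (Fin 3)) (hsDiameter σ N) (fun r => (Φ N).flow r z) ∩ Set.Ioc s (s + ((N : ℝ) + 1) ^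
    (-(1 / 3 : ℝ))), ∑ i : Fin (N + 1), ∑ j : Fin (N + 1), if i = j then (0 : ℝ≥0∞) else (contactSet
    (Torus.geometry (Fin 3)) (N + 1) (hsDiameter σ N) i j).indicator (fun y => if K₀ < ‖((collidePair
    (Torus.geometry (Fin 3)) i j y) i).2‖ then ENNReal.ofReal (((N + 1 : ℕ) : ℝ)⁻¹ * (2 * (‖(y i).2‖ ^ 2 *
    ‖(y j).2‖ ^ 2))) else 0) ((Φ N).flow τ z)) ∂(localGibbsLaw σ a₀ u₀ θ₀ N (Φ N)) := by
  intro hQ a₀ θ₀ u₀ ha hθ hu ha0 hθ0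
  obtain ⟨σ₀, hσ₀, H⟩ := hQ a₀ θ₀ u₀ ha hθ hu ha0 hθ0
  refine ⟨σ₀, hσ₀, fun σ hσ hσ0 T hT Φ => ?_⟩
  obtain ⟨K₀, hK₀, c, hc, N₀, HN⟩ := H σ hσ hσ0 T hT Φ
  refine ⟨K₀, hK₀, c, hc, N₀, fun N hN s hs hsT => ?_⟩
  have hH : 0 < ((N : ℝ) + 1) ^ (-(1 / 3 : ℝ)) := Real.rpow_pos_of_pos (by positivity) _
  have key := HN N hN s (s + ((N : ℝ) + 1) ^ (-(1 / 3 : ℝ))) hs (by linarith) hsT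
  exact le_trans (mul_le_mul_right (lintegral_mono_set (Set.Ioc_subset_Ioc_right (by linarith))) _) key

end Summit.AtomisticToContinuum.HydrodynamicLimit.Theorems.QuarticSchurLedger

end
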